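import Mathlib
import HarnessLib
import Summits.ValiantsHypothesis.ValiantsHypothesis.Theorems.LacunarySymmetroidMatrixDescartesProductPlusOneSharpSector

/-!
# ValiantsHypothesis / LacunarySymmetroid — crux `MatrixDescartes` (stmt-ValiantsHypothesis-18050, V1),
# LINE (A) «product_plus_one», research stub `stub_classRowK3`: SHARP DIPS IN THE POWER CHART (ratio ≥ 2) — CALCULUS

`…TameCalculus` shows that a NO-DIP factor (`a c < 0`) has a strictly decreasing normalised logarithmic derivative
`T = (p b + q c x^{q−p})/g` in the power chart `u = x^p` when the support ratio `q/p ≤ 4` (`numerator_neg`).  Here: a SHARP DIP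
(`a, c > 0`, negative somewhere) has the SAME property whenever `q/p ≥ 2` (`k ≥ e`): `dip_numerator_neg` — the identical numerator
expression is negative.  Certificate: at the critical scale `x*` with `p(−b) = q c x*^{q−p}` (IVT), the witness and Young give
`p a < (q−p) c x*^{q}` (`dip_a_lt`), and at `a* = (q−p) c x*^{q}/p` the numerator is `−c² q x^e x*^{2(q−p)} · H(x/x*)` with
`H(σ) = p² σ^{2(q−p)} + q(q−3p) σ^{q−p} − (q−p)² σ^{q−2p} + pq ≥ p² (σ^{q−p} − 1)² ≥ 0` (`H_nonneg`, by Young once more).  Consequence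
(`…ProductPlusOneMixedSector`): in the ratio window `2 ≤ q/p ≤ 4` no-dip and sharp-dip factors are monotone in ONE chart, so MIXED
members (every factor vanishing somewhere on `(0,∞)`) are linear: `Z₊ ≤ 4m + 2`.

HONEST FRAMING: a per-factor lemma; NOT `stub_classRowK3`, not `stub_polyLaw`, not `ProductPlusOneMDR`, not `MatrixDescartes`, not
Conjecture B; `VP ≠ VNP` is NOT proved.  No definitions, no named facts; Mathlib + the lane files.
-/

-- `Summit.ValiantsHypothesis.ValiantsHypothesis.…` is the tree's mandated single-conjunct layout (Sub = Summit).
set_option linter.dupNamespace false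

namespace Summit.ValiantsHypothesis.ValiantsHypothesis.Theorems.LacunarySymmetroidMatrixDescartes

namespace ProductPlusOne

open Polynomial Finset
open scoped BigOperators

/-- `H(σ) = p² σ^{2(q−p)} + q(q−3p) σ^{q−p} − (q−p)² σ^{q−2p} + pq ≥ 0` for `σ ≥ 0`, `q ≥ 2p` (here `p = e+1`, `q−p = k+1`, `q−2p = k−e`):
Young `(q−p) σ^{q−2p} ≤ (q−2p) σ^{q−p} + p` reduces it to `p² (σ^{q−p} − 1)² ≥ 0`. [folklore] -/
theorem H_nonneg (e k : ℕ) (hke : e ≤ k) (σ : ℝ) (hσ : 0 ≤ σ) :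
    0 ≤ ((e : ℝ) + 1) ^ 2 * σ ^ (2 * k + 2) + ((e : ℝ) + k + 2) * (((e : ℝ) + k + 2) - 3 * ((e : ℝ) + 1)) * σ ^ (k + 1)
      - ((k : ℝ) + 1) ^ 2 * σ ^ (k - e) + ((e : ℝ) + 1) * ((e : ℝ) + k + 2) := by
  -- Young: ((e+1) + (k−e)) σ^{k−e} · 1^{e+1} ≤ (k−e) σ^{k+1} + (e+1) · 1
  rcases eq_or_lt_of_le hσ with h0 | hσpos
  · rw [← h0]
    rcases Nat.eq_zero_or_pos (k - e) with hz | hz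
    · rw [hz, pow_zero, zero_pow (by omega), zero_pow (by omega)]
      have hk : (k : ℝ) = e := by
        have : k ≤ e := Nat.sub_eq_zero_iff_le.mp hz
        exact_mod_cast le_antisymm this hke
      rw [hk]; nlinarith
    · rw [zero_pow hz.ne', zero_pow (by omega), zero_pow (by omega)]
      nlinarith
  have hy := young_nat (e + 1) (k - e) σ 1 hσpos zero_le_one
  simp only [one_pow, mul_one] at hy
  have hke' : e + 1 + (k - e) = k + 1 := by omega
  rw [hke'] at hy
  push_cast at hy
  rw [Nat.cast_sub hke] at hy
  have hsq : 0 ≤ ((e : ℝ) + 1) ^ 2 * (σ ^ (k + 1) - 1) ^ 2 := by positivity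
  have e2 : σ ^ (2 * k + 2) = (σ ^ (k + 1)) ^ 2 := by rw [← pow_mul]; ring_nf
  rw [e2]
  nlinarith [hy, hsq, pow_nonneg hσ (k - e), pow_nonneg hσ (k + 1)]

/-- The power-chart critical scale of a dip: `(e+1)·β = (e+k+2)·c·x*^{k+1}` (`β = −b > 0`, `c > 0`). [folklore] -/
theorem exists_dip_scale (β c : ℝ) (hβ : 0 < β) (hc : 0 < c) (e k : ℕ) :
    ∃ xs : ℝ, 0 < xs ∧ ((e : ℝ) + k + 2) * c * xs ^ (k + 1) = ((e : ℝ) + 1) * β := by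
  -- reuse `exists_critical_scale` with (a, c, e, k) ↦ (β, c·(e+k+2)/(k+1), k−?…) is awkward; do IVT directly
  set M : ℝ := (e + 1) * β / ((e + k + 2) * c) + 1 with hM
  have hqc : 0 < ((e : ℝ) + k + 2) * c := by positivity
  have hM1 : 1 ≤ M := by
    have : 0 ≤ ((e : ℝ) + 1) * β / (((e : ℝ) + k + 2) * c) := by positivity
    linarith
  have hM0 : 0 < M := by linarith
  have hcont : ContinuousOn (fun x : ℝ => ((e : ℝ) + k + 2) * c * x ^ (k + 1)) (Set.Icc 0 M) :=
    (continuous_const.mul (continuous_pow _)).continuousOn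
  have hlo : (fun x : ℝ => ((e : ℝ) + k + 2) * c * x ^ (k + 1)) 0 ≤ ((e : ℝ) + 1) * β := by
    simp only [zero_pow (by omega : k + 1 ≠ 0), mul_zero]
    positivity
  have hhi : ((e : ℝ) + 1) * β ≤ (fun x : ℝ => ((e : ℝ) + k + 2) * c * x ^ (k + 1)) M := by
    simp only
    have hMp : M ≤ M ^ (k + 1) := le_self_pow₀ hM1 (by omega)
    have h1 : ((e : ℝ) + 1) * β ≤ ((e : ℝ) + k + 2) * c * M := by
      have hcm : ((e : ℝ) + k + 2) * c * M = ((e : ℝ) + 1) * β + ((e : ℝ) + k + 2) * c := by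
        rw [hM]
        field_simp
      rw [hcm]
      linarith
    exact h1.trans (mul_le_mul_of_nonneg_left hMp hqc.le)
  obtain ⟨xs, hxs, hval⟩ := intermediate_value_Icc hM0.le hcont ⟨hlo, hhi⟩
  have hxs0 : 0 < xs := by
    rcases eq_or_lt_of_le hxs.1 with h0 | h0
    · rw [← h0] at hval
      simp only [zero_pow (by omega : k + 1 ≠ 0), mul_zero] at hval
      have : 0 < ((e : ℝ) + 1) * β := by positivity
      linarith
    · exact h0
  exact ⟨xs, hxs0, hval⟩

/-- **`p a < (q−p) c x*^{q}`**: a dip value below zero forces `a` below the critical value `a*`. [this file's lemma] -/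
theorem dip_a_lt (a b c x₀ xs : ℝ) (e k : ℕ) (hc : 0 < c) (hx₀ : 0 < x₀) (hxs : 0 < xs)
    (hscale : ((e : ℝ) + k + 2) * c * xs ^ (k + 1) = ((e : ℝ) + 1) * (-b))
    (hneg : a + b * x₀ ^ (e + 1) + c * x₀ ^ (e + k + 2) < 0) :
    ((e : ℝ) + 1) * a < ((k : ℝ) + 1) * c * xs ^ (e + k + 2) := by
  -- Young: ((e+1) + (k+1)) xs^{k+1} x₀^{e+1} ≤ (k+1) xs^{e+k+2} + (e+1) x₀^{e+k+2}
  have hy := young_nat (e + 1) (k + 1) xs x₀ hxs hx₀.le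
  push_cast at hy
  rw [show e + 1 + (k + 1) = e + k + 2 by ring] at hy
  -- (e+1) a < (e+1)(−b) x₀^{e+1} − (e+1) c x₀^{e+k+2} = (e+k+2) c xs^{k+1} x₀^{e+1} − (e+1) c x₀^{e+k+2} ≤ (k+1) c xs^{e+k+2}
  have h1 : ((e : ℝ) + 1) * a < ((e : ℝ) + 1) * (-b) * x₀ ^ (e + 1) - ((e : ℝ) + 1) * c * x₀ ^ (e + k + 2) := by
    have : ((e : ℝ) + 1) * (a + b * x₀ ^ (e + 1) + c * x₀ ^ (e + k + 2)) < 0 :=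
      mul_neg_of_pos_of_neg (by positivity) hneg
    nlinarith
  rw [← hscale] at h1
  have h2 := mul_le_mul_of_nonneg_left hy hc.le
  nlinarith [h1, h2]

/-- **The power-chart numerator of a SHARP DIP is negative** (ratio ≥ 2, i.e. `e ≤ k`): for `a, c > 0`, a witness `g(x₀) < 0`, and
`x > 0`, the numerator of `T′` (same expression as `numerator_neg`) is `< 0`. [this file's theorem] -/
theorem dip_numerator_neg (a b c x₀ : ℝ) (e k : ℕ) (hke : e ≤ k) (ha : 0 < a) (hc : 0 < c) (hx₀ : 0 < x₀)
    (hneg : a + b * x₀ ^ (e + 1) + c * x₀ ^ (e + k + 2) < 0) {x : ℝ} (hx : 0 < x) :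
    ((e + k + 2 : ℝ) * c * ((k + 1 : ℝ) * x ^ k)) * (a + b * x ^ (e + 1) + c * x ^ (e + k + 2))
      - ((e + 1 : ℝ) * b + (e + k + 2 : ℝ) * c * x ^ (k + 1))
        * (b * ((e + 1 : ℝ) * x ^ e) + c * ((e + k + 2 : ℝ) * x ^ (e + k + 1))) < 0 := by
  -- b < 0 from the witness
  have hb : 0 < -b := by
    have h1 : 0 < x₀ ^ (e + 1) := pow_pos hx₀ _
    have h2 : 0 ≤ c * x₀ ^ (e + k + 2) := by positivity
    nlinarith
  obtain ⟨xs, hxs, hscale⟩ := exists_dip_scale (-b) c hb hc e k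
  have halt := dip_a_lt a b c x₀ xs e k hc hx₀ hxs hscale hneg
  -- the numerator as `A(x)·a + B(x)` with A > 0, and its value at a* = (k+1) c xs^{e+k+2}/(e+1)
  have hid : ((e + k + 2 : ℝ) * c * ((k + 1 : ℝ) * x ^ k)) * (a + b * x ^ (e + 1) + c * x ^ (e + k + 2))
      - ((e + 1 : ℝ) * b + (e + k + 2 : ℝ) * c * x ^ (k + 1))
        * (b * ((e + 1 : ℝ) * x ^ e) + c * ((e + k + 2 : ℝ) * x ^ (e + k + 1)))
      = a * c * ((e + k + 2 : ℝ) * (k + 1 : ℝ)) * x ^ k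
        + x ^ e * ((e + k + 2 : ℝ) * ((e + k + 2 : ℝ) - 3 * (e + 1 : ℝ)) * b * c * x ^ (k + 1)
          - (e + 1 : ℝ) * (e + k + 2 : ℝ) * c ^ 2 * (x ^ (k + 1)) ^ 2 - (e + 1 : ℝ) ^ 2 * b ^ 2) := by
    ring
  rw [hid]
  obtain ⟨j, hj⟩ : ∃ j, k = e + j := ⟨k - e, by omega⟩
  subst hj
  push_cast
  -- notation-free abbreviations of the pieces
  have hp : (0 : ℝ) < (e : ℝ) + 1 := by positivity
  have hxe : 0 < x ^ e := pow_pos hx e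
  set σ := x / xs with hσ
  have hσ0 : 0 ≤ σ := div_nonneg hx.le hxs.le
  have hxσ : x = σ * xs := by rw [hσ, div_mul_cancel₀ x hxs.ne']
  have hH := H_nonneg e (e + j) (by omega) σ hσ0
  rw [show e + j - e = j by omega] at hH
  push_cast at hH hscale halt
  -- b in terms of the scale
  have hb' : b = -(((e : ℝ) + (e + j) + 2) * c * xs ^ (e + j + 1)) / ((e : ℝ) + 1) := by
    rw [eq_div_iff hp.ne']
    linarith
  -- STEP 1: the expression is affine increasing in `a`; replace `a` by `a*` with `(e+1) a* = (e+j+1) c xs^{e+(e+j)+2}`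
  have hA : 0 < c * (((e : ℝ) + (e + j) + 2) * (((e : ℝ) + j) + 1)) * x ^ (e + j) := by
    have : 0 < ((e : ℝ) + j) + 1 := by positivity
    positivity
  have step1 : ((e : ℝ) + 1) * (a * c * (((e : ℝ) + (e + j) + 2) * (((e : ℝ) + j) + 1)) * x ^ (e + j))
      < (((e : ℝ) + j) + 1) * c * xs ^ (e + (e + j) + 2) * (c * (((e : ℝ) + (e + j) + 2) * (((e : ℝ) + j) + 1)) * x ^ (e + j)) := by
    have := mul_lt_mul_of_pos_right halt hA
    linarith
  -- STEP 2: at `a*` the expression is `−c² q x^e xs^{2k+2} · H(σ)`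
  have step2 : (((e : ℝ) + j) + 1) * c * xs ^ (e + (e + j) + 2) * (c * (((e : ℝ) + (e + j) + 2) * (((e : ℝ) + j) + 1)) * x ^ (e + j))
      + ((e : ℝ) + 1) * (x ^ e * (((e : ℝ) + (e + j) + 2) * (((e : ℝ) + (e + j) + 2) - 3 * ((e : ℝ) + 1)) * b * c * x ^ (e + j + 1)
          - ((e : ℝ) + 1) * ((e : ℝ) + (e + j) + 2) * c ^ 2 * (x ^ (e + j + 1)) ^ 2 - ((e : ℝ) + 1) ^ 2 * b ^ 2))
      = -(c ^ 2 * ((e : ℝ) + (e + j) + 2) * x ^ e * xs ^ (2 * (e + j) + 2))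
        * (((e : ℝ) + 1) ^ 2 * σ ^ (2 * (e + j) + 2)
          + ((e : ℝ) + (e + j) + 2) * (((e : ℝ) + (e + j) + 2) - 3 * ((e : ℝ) + 1)) * σ ^ (e + j + 1)
          - (((e : ℝ) + j) + 1) ^ 2 * σ ^ j + ((e : ℝ) + 1) * ((e : ℝ) + (e + j) + 2)) := by
    rw [hb', hxσ]
    field_simp
    ring
  have hpre : 0 ≤ c ^ 2 * ((e : ℝ) + (e + j) + 2) * x ^ e * xs ^ (2 * (e + j) + 2) := by positivity
  have hH' : 0 ≤ ((e : ℝ) + 1) ^ 2 * σ ^ (2 * (e + j) + 2)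
          + ((e : ℝ) + (e + j) + 2) * (((e : ℝ) + (e + j) + 2) - 3 * ((e : ℝ) + 1)) * σ ^ (e + j + 1)
          - (((e : ℝ) + j) + 1) ^ 2 * σ ^ j + ((e : ℝ) + 1) * ((e : ℝ) + (e + j) + 2) := by
    have e1 : ((e : ℝ) + ↑(e + j) + 2) = ((e : ℝ) + (e + j) + 2) := by push_cast; ring
    have e2 : ((↑(e + j) : ℝ) + 1) = (((e : ℝ) + j) + 1) := by push_cast; ring
    have e3 : (e + j + 1) = (e + j + 1) := rfl
    simpa [e1, e2] using hH
  have key : ((e : ℝ) + 1) * (a * c * (((e : ℝ) + (e + j) + 2) * (((e : ℝ) + j) + 1)) * x ^ (e + j)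
      + x ^ e * (((e : ℝ) + (e + j) + 2) * (((e : ℝ) + (e + j) + 2) - 3 * ((e : ℝ) + 1)) * b * c * x ^ (e + j + 1)
          - ((e : ℝ) + 1) * ((e : ℝ) + (e + j) + 2) * c ^ 2 * (x ^ (e + j + 1)) ^ 2 - ((e : ℝ) + 1) ^ 2 * b ^ 2)) < 0 := by
    have hneg2 : -(c ^ 2 * ((e : ℝ) + (e + j) + 2) * x ^ e * xs ^ (2 * (e + j) + 2))
        * (((e : ℝ) + 1) ^ 2 * σ ^ (2 * (e + j) + 2)
          + ((e : ℝ) + (e + j) + 2) * (((e : ℝ) + (e + j) + 2) - 3 * ((e : ℝ) + 1)) * σ ^ (e + j + 1)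
          - (((e : ℝ) + j) + 1) ^ 2 * σ ^ j + ((e : ℝ) + 1) * ((e : ℝ) + (e + j) + 2)) ≤ 0 := by
      rw [neg_mul]
      exact neg_nonpos.mpr (mul_nonneg hpre hH')
    rw [mul_add]
    linarith [step1, step2, hneg2]
  by_contra hcon
  push Not at hcon
  have := mul_nonneg hp.le hcon
  linarith

end ProductPlusOne


end Summit.ValiantsHypothesis.ValiantsHypothesis.Theorems.LacunarySymmetroidMatrixDescartes
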